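import Mathlib.Topology.Algebra.OpenSubgroup
import Mathlib.CategoryTheory.Galois.Topology
import Literature.AnabelianGeometry.SemiGraphs.Commensurability

/-!
# [SemiAnbd] Corollary 2.7 (ii) from Corollary 2.7 (i) (proof-only companion of `Commensurability.lean`)

Mochizuki, *Semi-graphs of anabelioids*, Publ. RIMS **42** (2006) 221–322, §2, author's manuscript
p. 30, proof of Corollary 2.7 (ii) [cite: MochizukiSemiAnbd2006, Cor. 2.7(ii) p.30]: "By assertion
(i), we have, for any open subgroup `H ⊆ Π_ℍ`: `Z_{Π_𝒢}(H) ⊆ Z_{Π_𝒢}(H ∩ Π_v) ⊆ C_{Π_𝒢}(Π_v) = Π_v`.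
Thus, we conclude [since `𝒢_v` is slim] that `Z_{Π_𝒢}(H) ⊆ Z_{Π_v}(H ∩ Π_v) = {1}`."

This file kernel-checks that printed deduction: the named fact `corollary_2_7_ii` follows from the
named facts `corollary_2_7_i` (second clause, `C_{Π_𝒢}(Π_v) = Π_v`) and `proposition_2_5_i` (second
clause, injectivity of `Π_v → Π_𝒢`, which the print uses tacitly when it regards `Π_v` as a subgroup
of `Π_𝒢`) — `corollary_2_7_ii_of_corollary_2_7_i`.  Ingredients made explicit: continuity of the
induced homomorphism of fundamental groups `pi1Map` (for Mathlib's topology on `Aut F`), so that the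
pull-back of an open subgroup of `Π_ℍ` to `Π_v` is open, hence of finite index in the compact group
`Π_v`; an element centralising a finite-index subgroup of `Π_v` commensurates `Π_v`.

No new definitions; statements untouched (discharge companion; the deep inputs Cor. 2.7 (i) and
Prop. 2.5 (i) are NOT proved here).
-/

namespace Literature.AnabelianGeometry.SemiGraphs

open CategoryTheory CategoryTheory.PreGaloisCategory
open Literature.AnabelianGeometry.Anabelioids
open Literature.AnabelianGeometry.AbsoluteAnabelian
open Literature.AlgebraicGeometry.Frobenioids (IsSlimGroup)
open scoped Pointwise

universe v₁ u₁ u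

/-! ### Continuity of the induced homomorphism of fundamental groups -/

section Continuity

variable {X : Type*} [Category X] {Y : Type*} [Category Y]

/-- The homomorphism `π₁(X, β) → π₁(Y, φ ∘ β)` induced by a morphism of connected anabelioids is
continuous ([GeoAn] §1.1: fundamental groups are profinite and induced morphisms are morphisms of
profinite groups), for Mathlib's topology on `Aut F` (induced from `∏_B Aut (F B)`).
[cite: MochizukiGeoAn2004, Def. 1.1.2(ii) p.10] -/
theorem continuous_pi1Map (P : Y ⥤ X) (F : X ⥤ FintypeCat.{v₁}) : Continuous (pi1Map P F) := by
  refine continuous_induced_rng.2 (continuous_pi fun B => ?_)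
  have h1 : Continuous (autEmbedding F) := continuous_induced_dom
  have h2 : Continuous (fun t : (∀ A : X, Aut (F.obj A)) => t (P.obj B)) := continuous_apply (P.obj B)
  exact h2.comp h1

end Continuity

/-! ### Group-theoretic lemmas -/

section GroupTheory

variable {G : Type*} [Group G]

/-- An element centralising a subgroup `D` of finite index in `K` commensurates `K`. [folklore] -/
private theorem mem_commensurator_of_mem_centralizer {K D : Subgroup G} (hDK : D ≤ K)
    (hD : D.relIndex K ≠ 0) {z : G} (hz : z ∈ Subgroup.centralizer (D : Set G)) :
    z ∈ Subgroup.Commensurable.commensurator K := by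
  rw [Subgroup.Commensurable.commensurator_mem_iff]
  -- `z D z⁻¹ = D`
  have hzD : ConjAct.toConjAct z • D = D := by
    ext x
    rw [Subgroup.mem_smul_pointwise_iff_exists]
    constructor
    · rintro ⟨s, hs, rfl⟩
      rw [ConjAct.smul_def, ConjAct.ofConjAct_toConjAct, ← Subgroup.mem_centralizer_iff.mp hz s hs,
        mul_inv_cancel_right]
      exact hs
    · intro hx
      refine ⟨x, hx, ?_⟩
      rw [ConjAct.smul_def, ConjAct.ofConjAct_toConjAct, ← Subgroup.mem_centralizer_iff.mp hz x hx,
        mul_inv_cancel_right]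
  have hDzK : D ≤ ConjAct.toConjAct z • K := by
    rw [← hzD]
    exact Subgroup.pointwise_smul_le_pointwise_smul_iff.mpr hDK
  have hDzK' : D.relIndex (ConjAct.toConjAct z • K) ≠ 0 := by
    rw [← hzD]
    intro h0
    apply hD
    have e1 := Subgroup.relIndex_map_map_of_injective
      (f := MulDistribMulAction.toMonoidEnd (ConjAct G) G (ConjAct.toConjAct z)) D K
      (MulAction.injective (ConjAct.toConjAct z))
    rw [← Subgroup.pointwise_smul_def, ← Subgroup.pointwise_smul_def] at e1
    rw [← e1]
    exact h0
  constructor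
  · intro h0
    exact hD (Nat.eq_zero_of_zero_dvd (h0 ▸ Subgroup.relIndex_dvd_of_le_left K hDzK))
  · intro h0
    exact hDzK' (Nat.eq_zero_of_zero_dvd (h0 ▸ Subgroup.relIndex_dvd_of_le_left _ hDK))

end GroupTheory

namespace SemiGraphOfAnabelioids

/-- The restriction functor to `𝒢_ℍ` followed by `ρ^ℍ_w` is `ρ_w`, on fundamental groups:
`Π_v → Π_ℍ → Π_𝒢` is `Π_v → Π_𝒢` (p. 24). [cite: MochizukiSemiAnbd2006, Def. 2.1 p.24] -/
theorem piHToPi_comp_piVToPi (𝒢 : SemiGraphOfAnabelioids.{v₁, u₁, u}) (H : 𝒢.graph.Subgraph)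
    (w : H.toSemiGraph.Vertex) (F : 𝒢.V w.1 ⥤ FintypeCat.{v₁}) :
    (𝒢.piHToPi H w F).comp ((𝒢.restrict H).piVToPi w F) = 𝒢.piVToPi w.1 F := by
  ext σ B x
  rfl

/-- **[SemiAnbd] Corollary 2.7 (ii) from Corollary 2.7 (i)** (proof of Cor. 2.7, p. 30: "By assertion
(i), we have, for any open subgroup `H ⊆ Π_ℍ`: `Z_{Π_𝒢}(H) ⊆ Z_{Π_𝒢}(H ∩ Π_v) ⊆ C_{Π_𝒢}(Π_v) = Π_v`.
Thus … `Z_{Π_𝒢}(H) ⊆ Z_{Π_v}(H ∩ Π_v) = {1}`").  The injectivity of `Π_v → Π_𝒢` (Proposition 2.5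
(i)), used tacitly in print, is an explicit hypothesis. [cite: MochizukiSemiAnbd2006, Cor. 2.7(ii) p.30] -/
theorem corollary_2_7_ii_of_corollary_2_7_i (h25 : proposition_2_5_i.{v₁, u₁, u})
    (h27 : corollary_2_7_i.{v₁, u₁, u}) : corollary_2_7_ii.{v₁, u₁, u} := by
  intro 𝒢 hconn hgraph hqc H hH _ helev w hslim F _
  -- notation
  have hinj : Function.Injective (𝒢.piVToPi w.1 F) := (h25 𝒢 hconn hgraph hqc).2.1 w.1 F
  have hct : AbsoluteAnabelian.IsCommensurablyTerminal (𝒢.piVToPi w.1 F).range :=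
    (h27 𝒢 hconn hgraph hqc).2 w.1 (helev w) F
  have hslimv : IsSlimGroup (Aut F) := hslim.isSlimGroup F
  -- relative slimness of `Π_ℍ → Π_𝒢`
  have hrel : IsRelativelySlim (𝒢.piHToPi H w F) := by
    refine ⟨fun U hU => ?_⟩
    rw [eq_bot_iff]
    intro z hz
    -- the open subgroup `U' = U ∩ Π_v` of `Π_v`
    set U' : Subgroup (Aut F) := U.comap ((𝒢.restrict H).piVToPi w F) with hU'
    have hU'open : IsOpen (U' : Set (Aut F)) :=
      (continuous_def.mp (continuous_pi1Map ((𝒢.restrict H).ρ w) F)) _ hU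
    -- `z` centralises the image of `U'` in `Π_𝒢`
    have hz' : z ∈ Subgroup.centralizer ((U'.map (𝒢.piVToPi w.1 F) : Subgroup (𝒢.Pi w.1 F)) :
        Set (𝒢.Pi w.1 F)) := by
      refine Subgroup.centralizer_le ?_ hz
      rintro x ⟨u, hu, rfl⟩
      exact ⟨(𝒢.restrict H).piVToPi w F u, hu, DFunLike.congr_fun (piHToPi_comp_piVToPi 𝒢 H w F) u⟩
    -- `U'` has finite index in the compact group `Π_v`
    have hidx : (U'.map (𝒢.piVToPi w.1 F)).relIndex (𝒢.piVToPi w.1 F).range ≠ 0 := by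
      rw [MonoidHom.range_eq_map, Subgroup.relIndex_map_map_of_injective _ _ hinj,
        Subgroup.relIndex_top_right]
      haveI : Finite (Aut F ⧸ U') := Subgroup.quotient_finite_of_isOpen U' hU'open
      exact Subgroup.index_ne_zero_of_finite
    -- hence `z` commensurates `Π_v`, so `z ∈ Π_v`
    have hzC : z ∈ Subgroup.Commensurable.commensurator (𝒢.piVToPi w.1 F).range :=
      mem_commensurator_of_mem_centralizer (Subgroup.map_le_range _ _) hidx hz'
    rw [hct.commensurator_eq] at hzC
    obtain ⟨y, rfl⟩ := hzC
    -- `y` centralises `U'`, so `y = 1` by slimness of `𝒢_v`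
    have hy : y ∈ Subgroup.centralizer (U' : Set (Aut F)) := by
      rw [Subgroup.mem_centralizer_iff]
      intro u hu
      apply hinj
      rw [map_mul, map_mul]
      exact Subgroup.mem_centralizer_iff.mp hz' _ ⟨u, hu, rfl⟩
    rw [(hslimv.centralizer_eq_bot U' hU'open)] at hy
    rw [Subgroup.mem_bot] at hy
    rw [hy, map_one]
    exact Subgroup.one_mem _
  refine ⟨hrel, ⟨fun U hU => ?_⟩⟩
  -- slimness of `Π_𝒢` from relative slimness of `Π_ℍ → Π_𝒢`
  rw [eq_bot_iff]
  set U₀ := U.comap (𝒢.piHToPi H w F) with hU₀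
  have hU₀open : IsOpen (U₀ : Set (𝒢.PiH H w F)) :=
    (continuous_def.mp (continuous_pi1Map (𝒢.restrictFunctor H) ((𝒢.restrict H).ρ w ⋙ F))) _ hU
  have h1 := hrel.centralizer_eq_bot U₀ hU₀open
  rw [← h1]
  refine Subgroup.centralizer_le ?_
  rintro x ⟨u, hu, rfl⟩
  exact hu

end SemiGraphOfAnabelioids

end Literature.AnabelianGeometry.SemiGraphs
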